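import Mathlib
import Literature.NumberTheory.LFunctions.Zhang2022.Section7MeanSquareMajorant
import HarnessLib

/-!
# Zhang (2022), Appendix B: the arithmetic function `ϱ_j` and the abstract form of (B.2)

Topic `Literature/NumberTheory/LFunctions/Zhang2022` (Landau–Siegel audit tree; verdict-neutral).
Y. Zhang, *Discrete mean estimates and the Landau–Siegel zero*, arXiv:2211.02515v1 (2022)
[Zhang2022LandauSiegel] — **an unrefereed manuscript under adjudication**; this file and its companions
`AppendixBVarrhoB2`, `AppendixBVarrhoB1` PROVE the two displayed arithmetic estimates (B.1), (B.2) of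
its Appendix B (proof of Lemma 15.1, pp. 106–107 of the source, tex L5248–5285) about
`ϱ_j(n) = Σ_{d∣n} μ(d)d^{β_j}` (App. B, first display) and `ϱ*_j(n) = Σ_{d∣n} d^{β_j}χ(d)` ((15.21)),
`β_j` purely imaginary ((2.13)). Here, with a real parameter `v` (`β_j = iv`):

* `rho v n = Σ_{d∣n} μ(d)d^{iv}` and its arithmetic-function form `rhoAF v = (μ·n^{iv}) ∗ 1`
  (multiplicative; `ϱ_v(q^k) = 1 − q^{iv}`, "`ϱ_j(q^r) = ϱ_j(q)`"; `|ϱ_v(q^k)| ≤ |v| log q`,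
  "`ϱ_j(q) ≪ α log q`", via the tree's `MeanSquareMajorant.powI`);
* `sum_norm_rho_div_le`: `Σ_{n≤X} |ϱ_v(n)|/n ≤ majorantConst 0 1 · e^{|v| log 4X}` (the tree's
  Hall–Tenenbaum majorant `MeanSquareMajorant.sum_div_le`; `O(1)` when `|v| log X = O(1)`);
* `sum_filter_dvd_le`: for a prime `q`, `Σ_{n≤X, q∣n} |ϱ_v(n)|/n ≤ (2|ϱ_v(q)|/q)·Σ_{n≤X}|ϱ_v(n)|/n`
  (self-similarity of the `q`-multiples: `T ≤ (|ϱ_v(q)|/q)F + T/q`);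
* `sum_filter_not_coprime_le`: a number not coprime to `∏_{q∈S} q` (`S` primes) has a prime factor in
  `S` — the union bound;
* `sum_norm_rho_div_not_coprime_le` — **(B.2), abstract form**:
  `Σ_{n≤X, (n,∏S)>1} |ϱ_v(n)|/n ≤ 2·majorantConst 0 1·e^{|v| log 4X}·|v|·Σ_{q∈S} log q/q`.
  The source's one-line proof ("`≤ (Σ_{q<D⁴}|ϱ_j(q)|/q)·∏_{q<P}(1 + |ϱ_j(q)|/q + O(q⁻²)) ≪
  α Σ_{q<D⁴} log q/q`") is this with `S = {q < D⁴}`; the specialisation `≪ 𝓛⁻⁸` is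
  `AppendixBVarrhoB2.appB2_bound`.

What is deliberately NOT here: the parameters of the source (companion files), the rest of the proof of
Lemma 15.1 (residues: `Zhang2022.AppendixB`), any claim about Theorems 1–2 of the source or about
Landau–Siegel zeros. DAG node (cell siegel-zhang): `Z22:(B.2)` (abstract core).
-/

noncomputable section

open Complex Real Finset ArithmeticFunction

namespace Literature.NumberTheory.LFunctions.Zhang2022.AppendixBVarrho

open Literature.NumberTheory.LFunctions.Zhang2022 MeanSquareMajorant

/-! ## `ϱ` with a real parameter: `ϱ_v(n) = Σ_{d∣n} μ(d) d^{iv}` -/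

/-- `ϱ_v(n) = Σ_{d∣n} μ(d)d^{iv}` — the source's `ϱ_j` (Appendix B, first display) with `β_j = iv`.
[cite: Zhang2022LandauSiegel, Appendix B (proof of Lemma 15.1)] -/
def rho (v : ℝ) (n : ℕ) : ℂ :=
  ∑ d ∈ n.divisors, (ArithmeticFunction.moebius d : ℂ) * (d : ℂ) ^ ((v : ℂ) * I)

/-- `ϱ_v` as an arithmetic function: the Dirichlet product `(μ · n^{iv}) ∗ 1` (`Σ_l ϱ_j(l)l^{−s} =
ζ(s)/ζ(s−β_j)`). [cite: Zhang2022LandauSiegel, Appendix B (proof of Lemma 15.1)] -/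
def rhoAF (v : ℝ) : ArithmeticFunction ℂ :=
  ((ArithmeticFunction.moebius : ArithmeticFunction ℂ).pmul (powI (-v))) *
    (ArithmeticFunction.zeta : ArithmeticFunction ℂ)

/-- `n^{iv}` is the tree's `powI (−v) n` for `n ≠ 0`. [folklore] -/
private theorem cpow_eq_powI (v : ℝ) {n : ℕ} (hn : n ≠ 0) : (n : ℂ) ^ ((v : ℂ) * I) = powI (-v) n := by
  rw [powI_apply_of_ne_zero _ hn]
  congr 1
  push_cast
  ring

/-- `rhoAF v n = ϱ_v(n)`. [cite: Zhang2022LandauSiegel, Appendix B (proof of Lemma 15.1)] -/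
theorem rhoAF_apply (v : ℝ) (n : ℕ) : rhoAF v n = rho v n := by
  rw [rhoAF, coe_mul_zeta_apply, rho]
  refine sum_congr rfl fun d hd => ?_
  have hd0 : d ≠ 0 := (Nat.pos_of_mem_divisors hd).ne'
  rw [pmul_apply, cpow_eq_powI v hd0, intCoe_apply]

/-- `ϱ_v` is multiplicative (used in the source through `ϱ_j(q^r) = ϱ_j(q)` and the Euler product
`∏_{q<P}(1 + |ϱ_j(q)|/q + O(q⁻²))`). [cite: Zhang2022LandauSiegel, Appendix B (proof of (B.2))] -/
theorem isMultiplicative_rhoAF (v : ℝ) : (rhoAF v).IsMultiplicative :=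
  (isMultiplicative_moebius.intCast.pmul (isMultiplicative_powI (-v))).mul
    isMultiplicative_zeta.natCast

/-- `ϱ_v(1) = 1`. [cite: Zhang2022LandauSiegel, Appendix B (proof of Lemma 15.1)] -/
theorem rho_one (v : ℝ) : rho v 1 = 1 := by
  simp [rho]

/-- `ϱ_v(mn) = ϱ_v(m)ϱ_v(n)` for coprime `m, n`. [cite: Zhang2022LandauSiegel, Appendix B (proof of (B.2))] -/
theorem rho_mul_of_coprime (v : ℝ) {m n : ℕ} (h : m.Coprime n) :
    rho v (m * n) = rho v m * rho v n := by
  rw [← rhoAF_apply, ← rhoAF_apply, ← rhoAF_apply]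
  exact (isMultiplicative_rhoAF v).map_mul_of_coprime h

/-- `ϱ_v(q^k) = 1 − q^{iv}` for a prime `q` and `k ≥ 1` ("`ϱ_j(q^r) = ϱ_j(q)` for any `r`").
[cite: Zhang2022LandauSiegel, Appendix B (proof of (B.2))] -/
theorem rho_prime_pow (v : ℝ) {q : ℕ} (hq : q.Prime) {k : ℕ} (hk : k ≠ 0) :
    rho v (q ^ k) = 1 - (q : ℂ) ^ ((v : ℂ) * I) := by
  rw [rho, Nat.divisors_prime_pow hq, Finset.sum_map]
  have h1 : (1 : ℕ) ∈ range (k + 1) := by simp; omega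
  have h0 : (0 : ℕ) ∈ range (k + 1) := by simp
  rw [Finset.sum_eq_add_of_mem 0 1 h0 h1 (by norm_num)]
  · simp [moebius_apply_prime hq]
    ring
  · intro c _ hc
    obtain ⟨hc0, hc1⟩ := hc
    have hc2 : c ≠ 0 := hc0
    simp only [Function.Embedding.coeFn_mk, Nat.cast_pow]
    rw [moebius_apply_prime_pow hq hc2, if_neg hc1]
    simp

/-- `|ϱ_v(q^k)| ≤ |v| log q` (`k ≥ 1`): `|1 − q^{iv}| ≤ |v| log q` ("`ϱ_j(q) ≪ α log q`").
[cite: Zhang2022LandauSiegel, Appendix B (proof of (B.2))] -/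
theorem norm_rho_prime_pow_le (v : ℝ) {q : ℕ} (hq : q.Prime) {k : ℕ} (hk : k ≠ 0) :
    ‖rho v (q ^ k)‖ ≤ |v| * Real.log q := by
  rw [rho_prime_pow v hq hk, norm_sub_rev, cpow_eq_powI v hq.ne_zero]
  simpa using norm_powI_sub_one_le (-v) hq.pos

/-- `|ϱ_v(q^k)| ≤ 2` (`k ≥ 1`). [cite: Zhang2022LandauSiegel, Appendix B (proof of (B.2))] -/
theorem norm_rho_prime_pow_le_two (v : ℝ) {q : ℕ} (hq : q.Prime) {k : ℕ} (hk : k ≠ 0) :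
    ‖rho v (q ^ k)‖ ≤ 2 := by
  rw [rho_prime_pow v hq hk, cpow_eq_powI v hq.ne_zero]
  calc ‖(1 : ℂ) - powI (-v) q‖ ≤ ‖(1 : ℂ)‖ + ‖powI (-v) q‖ := norm_sub_le _ _
    _ = 2 := by rw [norm_powI_of_pos (-v) hq.pos]; norm_num

/-! ## The full logarithmic sum `Σ_{n≤X} |ϱ_v(n)|/n = O(1)` (Hall–Tenenbaum majorant) -/

/-- `Σ_{n≤X} |ϱ_v(n)|/n ≤ majorantConst 0 1 · exp(|v| log 4X)` for `X ≥ 2` (the tree's Euler-product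
majorant `MeanSquareMajorant.sum_div_le` with `f = |ϱ_v|`, `f(p) ≤ |v| log p`, `f(p^ν) ≤ 2`); the
source's "`∏_{q<P}(1 + |ϱ_j(q)|/q + O(1/q²)) ≪ 1`". [cite: Zhang2022LandauSiegel, Appendix B (proof of (B.2))] -/
theorem sum_norm_rho_div_le (v : ℝ) {X : ℕ} (hX : 2 ≤ X) :
    ∑ n ∈ Icc 1 X, ‖rho v n‖ / n ≤ majorantConst 0 1 * Real.exp (|v| * Real.log (4 * X)) := by
  have h := MeanSquareMajorant.sum_div_le (f := fun n => ‖rho v n‖) (a := 0) (d := 1) (K := |v|)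
    (by simp [rho_one]) (fun m n hmn => by simp only [rho_mul_of_coprime v hmn, norm_mul])
    (fun n => norm_nonneg _) (abs_nonneg v)
    (fun p hp => by simpa using norm_rho_prime_pow_le v hp one_ne_zero)
    (fun p ν hp => ?_) hX
  · simpa using h
  · rcases Nat.eq_zero_or_pos ν with rfl | hν
    · simp [rho_one]
    · calc ‖rho v (p ^ ν)‖ ≤ 2 := norm_rho_prime_pow_le_two v hp hν.ne'
        _ ≤ ((ν : ℝ) + 1) ^ 1 := by
            have : (1 : ℝ) ≤ ν := by exact_mod_cast hν
            rw [pow_one]; linarith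

/-! ## The multiples of a fixed prime: `Σ_{n≤X, q∣n} |ϱ_v(n)|/n ≤ (2|ϱ_v(q)|/q)·Σ_{n≤X} |ϱ_v(n)|/n` -/

/-- `|ϱ_v(qm)| ≤ |ϱ_v(q)|·|ϱ_v(m)| + [q ∣ m]·|ϱ_v(m)|` for a prime `q` and `m ≥ 1`: equality with the
first term when `q ∤ m` (multiplicativity), and `ϱ_v(qm) = ϱ_v(m)` when `q ∣ m` (`ϱ_v(q^{s+1}) = ϱ_v(q^s)`).
[folklore] -/
private theorem norm_rho_prime_mul_le (v : ℝ) {q : ℕ} (hq : q.Prime) {m : ℕ} (hm : m ≠ 0) :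
    ‖rho v (q * m)‖ ≤ ‖rho v q‖ * ‖rho v m‖ + (if q ∣ m then ‖rho v m‖ else 0) := by
  obtain ⟨s, m', hm', rfl⟩ := Nat.exists_eq_pow_mul_and_not_dvd hm q hq.ne_one
  have hcop : ∀ t : ℕ, (q ^ t).Coprime m' := fun t =>
    (Nat.Coprime.pow_left t ((Nat.Prime.coprime_iff_not_dvd hq).mpr hm'))
  have hmul : q * (q ^ s * m') = q ^ (s + 1) * m' := by ring
  rcases Nat.eq_zero_or_pos s with rfl | hs
  · -- `q ∤ m = m'`
    have hndvd : ¬ q ∣ q ^ 0 * m' := by simpa using hm'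
    rw [if_neg hndvd, add_zero, pow_zero, one_mul,
      rho_mul_of_coprime v ((Nat.Prime.coprime_iff_not_dvd hq).mpr hm'), norm_mul]
  · have hdvd : q ∣ q ^ s * m' := Dvd.dvd.mul_right (dvd_pow_self q hs.ne') m'
    rw [if_pos hdvd, hmul, rho_mul_of_coprime v (hcop (s + 1)), rho_mul_of_coprime v (hcop s),
      rho_prime_pow v hq hs.ne', rho_prime_pow v hq (Nat.succ_ne_zero s), norm_mul]
    have h0 : 0 ≤ ‖rho v q‖ * (‖(1 : ℂ) - (q : ℂ) ^ ((v : ℂ) * I)‖ * ‖rho v m'‖) := by positivity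
    linarith

/-- The multiples of `q` in `[1, X]` are `q·[1, X/q]`. [folklore] -/
private theorem filter_dvd_Icc_eq_image {q : ℕ} (hq : 0 < q) (X : ℕ) :
    (Icc 1 X).filter (fun n => q ∣ n) = (Icc 1 (X / q)).image (fun m => q * m) := by
  ext n
  simp only [mem_filter, mem_Icc, mem_image]
  constructor
  · rintro ⟨⟨hn1, hnX⟩, ⟨m, rfl⟩⟩
    refine ⟨m, ⟨?_, ?_⟩, rfl⟩
    · rcases Nat.eq_zero_or_pos m with rfl | hm
      · simp at hn1
      · exact hm
    · calc m = q * m / q := (Nat.mul_div_cancel_left m hq).symm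
        _ ≤ X / q := Nat.div_le_div_right hnX
  · rintro ⟨m, ⟨hm1, hmX⟩, rfl⟩
    refine ⟨⟨Nat.mul_pos hq hm1, ?_⟩, dvd_mul_right q m⟩
    calc q * m ≤ q * (X / q) := Nat.mul_le_mul_left q hmX
      _ ≤ X := Nat.mul_div_le X q

/-- **Self-similarity of the `q`-multiples**: for a prime `q`,
`Σ_{n≤X, q∣n} |ϱ_v(n)|/n ≤ (2|ϱ_v(q)|/q) · Σ_{n≤X} |ϱ_v(n)|/n`. Writing `T` for the left side and `F`
for the full sum, `n = qm` and `norm_rho_prime_mul_le` give `T ≤ (|ϱ_v(q)|/q)F + T/q`, whence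
`T ≤ |ϱ_v(q)|F/(q−1) ≤ 2|ϱ_v(q)|F/q` (the source's factor `(Σ_{q<D⁴}|ϱ_j(q)|/q)` in front of
the Euler product). [cite: Zhang2022LandauSiegel, Appendix B (proof of (B.2))] -/
theorem sum_filter_dvd_le (v : ℝ) {q : ℕ} (hq : q.Prime) (X : ℕ) :
    ∑ n ∈ (Icc 1 X).filter (fun n => q ∣ n), ‖rho v n‖ / n ≤
      2 * ‖rho v q‖ / q * ∑ n ∈ Icc 1 X, ‖rho v n‖ / n := by
  set T := ∑ n ∈ (Icc 1 X).filter (fun n => q ∣ n), ‖rho v n‖ / n with hT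
  set F := ∑ n ∈ Icc 1 X, ‖rho v n‖ / n with hF
  have hq0 : (0 : ℝ) < q := by exact_mod_cast hq.pos
  have hq2 : (2 : ℝ) ≤ q := by exact_mod_cast hq.two_le
  have hF0 : 0 ≤ F := sum_nonneg fun n _ => div_nonneg (norm_nonneg _) (Nat.cast_nonneg _)
  have hT0 : 0 ≤ T := sum_nonneg fun n _ => div_nonneg (norm_nonneg _) (Nat.cast_nonneg _)
  -- reindex by `n = q m`
  have hre : T = ∑ m ∈ Icc 1 (X / q), ‖rho v (q * m)‖ / ((q : ℝ) * m) := by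
    rw [hT, filter_dvd_Icc_eq_image hq.pos, sum_image]
    · simp only [Nat.cast_mul]
    · intro a _ b _ hab
      exact Nat.eq_of_mul_eq_mul_left hq.pos hab
  -- the pointwise bound, summed
  have hsub : Icc 1 (X / q) ⊆ Icc 1 X := by
    intro m hm
    simp only [mem_Icc] at hm ⊢
    exact ⟨hm.1, hm.2.trans (Nat.div_le_self X q)⟩
  have hkey : T ≤ ‖rho v q‖ / q * F + T / q := by
    calc T = ∑ m ∈ Icc 1 (X / q), ‖rho v (q * m)‖ / ((q : ℝ) * m) := hre
      _ ≤ ∑ m ∈ Icc 1 (X / q),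
            (‖rho v q‖ * ‖rho v m‖ + (if q ∣ m then ‖rho v m‖ else 0)) / ((q : ℝ) * m) := by
          refine sum_le_sum fun m hm => ?_
          have hm1 : m ≠ 0 := by simp only [mem_Icc] at hm; omega
          exact div_le_div_of_nonneg_right (norm_rho_prime_mul_le v hq hm1) (by positivity)
      _ = ‖rho v q‖ / q * ∑ m ∈ Icc 1 (X / q), ‖rho v m‖ / m +
            (1 / q) * ∑ m ∈ (Icc 1 (X / q)).filter (fun m => q ∣ m), ‖rho v m‖ / m := by
          rw [sum_filter, mul_sum, mul_sum, ← sum_add_distrib]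
          refine sum_congr rfl fun m hm => ?_
          have hm0 : (m : ℝ) ≠ 0 := by
            simp only [mem_Icc] at hm; exact_mod_cast (show m ≠ 0 by omega)
          by_cases hqm : q ∣ m
          · rw [if_pos hqm, if_pos hqm]
            field_simp
          · rw [if_neg hqm, if_neg hqm]
            field_simp
            ring
      _ ≤ ‖rho v q‖ / q * F + (1 / q) * T := by
          gcongr
          · exact sum_le_sum_of_subset_of_nonneg hsub fun n _ _ =>
              div_nonneg (norm_nonneg _) (Nat.cast_nonneg _)
          · exact sum_le_sum_of_subset_of_nonneg (filter_subset_filter _ hsub) fun n _ _ =>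
              div_nonneg (norm_nonneg _) (Nat.cast_nonneg _)
      _ = ‖rho v q‖ / q * F + T / q := by ring
  -- solve the self-referential inequality
  have h1 : T * q ≤ ‖rho v q‖ * F + T := by
    calc T * q ≤ (‖rho v q‖ / q * F + T / q) * q := mul_le_mul_of_nonneg_right hkey hq0.le
      _ = ‖rho v q‖ * F + T := by field_simp
  rw [div_mul_eq_mul_div, le_div_iff₀ hq0]
  nlinarith [mul_nonneg (norm_nonneg (rho v q)) hF0, mul_nonneg hT0 (sub_nonneg.mpr hq2)]

/-! ## A number not coprime to `∏_{q∈S} q` has a prime factor in `S`: the union bound -/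

/-- If every member of `S` is prime and `g ≥ 0`, then
`Σ_{n∈A, (n, ∏S) > 1} g(n) ≤ Σ_{q∈S} Σ_{n∈A, q∣n} g(n)` (the source's split of "`(n,𝔮) > 1`" over
the primes `q < D⁴`). [cite: Zhang2022LandauSiegel, Appendix B (proof of (B.2))] -/
theorem sum_filter_not_coprime_le {S : Finset ℕ} (hS : ∀ q ∈ S, q.Prime) {g : ℕ → ℝ}
    (hg : ∀ n, 0 ≤ g n) (A : Finset ℕ) :
    ∑ n ∈ A.filter (fun n => ¬ Nat.Coprime n (∏ q ∈ S, q)), g n ≤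
      ∑ q ∈ S, ∑ n ∈ A.filter (fun n => q ∣ n), g n := by
  have hex : ∀ n, ¬ Nat.Coprime n (∏ q ∈ S, q) → ∃ q ∈ S, q ∣ n := by
    intro n hn
    by_contra h
    push Not at h
    exact hn (Nat.Coprime.prod_right fun q hq =>
      (Nat.coprime_comm.mp ((Nat.Prime.coprime_iff_not_dvd (hS q hq)).mpr (h q hq))))
  calc ∑ n ∈ A.filter (fun n => ¬ Nat.Coprime n (∏ q ∈ S, q)), g n
      ≤ ∑ n ∈ A.filter (fun n => ¬ Nat.Coprime n (∏ q ∈ S, q)),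
          ∑ q ∈ S.filter (fun q => q ∣ n), g n := by
        refine sum_le_sum fun n hn => ?_
        obtain ⟨q, hqS, hqn⟩ := hex n (mem_filter.mp hn).2
        rw [sum_const, nsmul_eq_mul]
        have hc : (1 : ℝ) ≤ (S.filter (fun q => q ∣ n)).card := by
          exact_mod_cast card_pos.mpr ⟨q, mem_filter.mpr ⟨hqS, hqn⟩⟩
        nlinarith [hg n]
    _ ≤ ∑ n ∈ A, ∑ q ∈ S.filter (fun q => q ∣ n), g n :=
        sum_le_sum_of_subset_of_nonneg (filter_subset _ _) fun n _ _ =>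
          sum_nonneg fun q _ => hg n
    _ = ∑ q ∈ S, ∑ n ∈ A.filter (fun n => q ∣ n), g n := by
        simp only [sum_filter]
        exact sum_comm

/-! ## (B.2), abstract form -/

/-- **(B.2), abstract form.** For a finite set `S` of primes, any real `v` and `X ≥ 2`:
`Σ_{n≤X, (n,∏S)>1} |ϱ_v(n)|/n ≤ 2·majorantConst 0 1·e^{|v| log 4X} · |v|·Σ_{q∈S} log q/q`.
[cite: Zhang2022LandauSiegel, Appendix B (B.2)] -/
theorem sum_norm_rho_div_not_coprime_le (v : ℝ) {S : Finset ℕ} (hS : ∀ q ∈ S, q.Prime) {X : ℕ}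
    (hX : 2 ≤ X) :
    ∑ n ∈ (Icc 1 X).filter (fun n => ¬ Nat.Coprime n (∏ q ∈ S, q)), ‖rho v n‖ / n ≤
      2 * (majorantConst 0 1 * Real.exp (|v| * Real.log (4 * X))) *
        (|v| * ∑ q ∈ S, Real.log q / q) := by
  set F := ∑ n ∈ Icc 1 X, ‖rho v n‖ / n with hF
  have hF0 : 0 ≤ F := sum_nonneg fun n _ => div_nonneg (norm_nonneg _) (Nat.cast_nonneg _)
  have hFle : F ≤ majorantConst 0 1 * Real.exp (|v| * Real.log (4 * X)) := sum_norm_rho_div_le v hX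
  calc ∑ n ∈ (Icc 1 X).filter (fun n => ¬ Nat.Coprime n (∏ q ∈ S, q)), ‖rho v n‖ / n
      ≤ ∑ q ∈ S, ∑ n ∈ (Icc 1 X).filter (fun n => q ∣ n), ‖rho v n‖ / n :=
        sum_filter_not_coprime_le hS (fun n => div_nonneg (norm_nonneg _) (Nat.cast_nonneg _)) _
    _ ≤ ∑ q ∈ S, 2 * ‖rho v q‖ / q * F := sum_le_sum fun q hq => sum_filter_dvd_le v (hS q hq) X
    _ ≤ ∑ q ∈ S, 2 * (|v| * Real.log q) / q * F := by
        refine sum_le_sum fun q hq => ?_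
        have h := norm_rho_prime_pow_le v (hS q hq) one_ne_zero
        rw [pow_one] at h
        have hq0 : (0 : ℝ) < q := by exact_mod_cast (hS q hq).pos
        gcongr
    _ = 2 * F * (|v| * ∑ q ∈ S, Real.log q / q) := by
        rw [Finset.mul_sum S, Finset.mul_sum S]
        exact sum_congr rfl fun q _ => by ring
    _ ≤ 2 * (majorantConst 0 1 * Real.exp (|v| * Real.log (4 * X))) *
          (|v| * ∑ q ∈ S, Real.log q / q) := by
        have hs : 0 ≤ |v| * ∑ q ∈ S, Real.log q / q :=
          mul_nonneg (abs_nonneg v) (sum_nonneg fun q hq =>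
            div_nonneg (Real.log_nonneg (by exact_mod_cast (hS q hq).one_lt.le)) (Nat.cast_nonneg _))
        gcongr

end Literature.NumberTheory.LFunctions.Zhang2022.AppendixBVarrho
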